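import Summits.CriticalPhenomena.PercolationContinuityZ3.Theorems.PercNearOneGluingNoHeavyLowerTailKnQuestion8CoefficientwiseZoneFlip
import HarnessLib

/-!
# The half-zone flip at a vertex: a bijection of colourings exchanging 'v ∉ blue cluster of x' and 'v ∉ red cluster of x'

Support file (`--supports stmt-CriticalPhenomena-4575`, closed), prover `prim-cplus-coupling` (gen 28).  No definitions, no notations, no named
facts, no sorries; standard axioms.  Memo `prim-cplus-coupling/A5-COUPLING-gen28.md` §3 (deg-2 decomposition) and §5.

Setting as in prim-lf-2's `Coefficientwise` files (`ends : ι → Sym2 V`, colourings `s : Finset ι` = red edges, `C_v(s) = openCluster (ends '' s) v`).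
THE HALF-ZONE FLIP at `v`:  `Π_v(s) := s ∆ M_v(s)`, `M_v(s)` := the edges meeting the BLUE cluster `C_v(sᶜ)` of `v` (compare the zone flip `P_z` of
…CoefficientwiseZoneFlip, which recolours the edges at both clusters).  This file proves, for any `M` with `i ∈ M ↔ ∃ u ∈ C_v(sᶜ), u ∈ ends i`:
* `Coefficientwise.openCluster_halfFlip` — `C_v(s ∆ M) = C_v(sᶜ)`: after the flip the RED cluster of `v` is its old blue cluster (so the flip is undone by recolouring
  the edges at the new red cluster of `v`: `Π_v` is a bijection of all colourings, inverse = the red half-zone flip; `halfFlip_halfFlip`);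
* `Coefficientwise.openCluster_halfFlip_subset` — for `x ∉ C_v(sᶜ)`: `C_x(s ∆ M) ⊆ C_x(s)` (the red cluster of `x` can only shrink: no red edge enters `V(C_v sᶜ)`);
* `Coefficientwise.openCluster_halfFlip_compl_supset` — for `x ∉ C_v(sᶜ)`: `C_x(sᶜ) ⊆ C_x((s ∆ M)ᶜ)` (the blue cluster of `x` can only grow);
* `Coefficientwise.halfFlip_mem` — `x ∉ C_v((s ∆ M))`, i.e. `Π_v` maps `{v ∉ C_x(sᶜ)}` into `{v ∉ C_x(s ∆ M)}`, and preserves `{u ∉ C_x(·)}` for every `u`.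
So `Π_v : {v ∉ L} → {v ∉ K}` is a bijection with `K′ ⊆ K`, `L′ ⊇ L` (memo: for a conditioning vertex `z` of degree 2 with neighbours `v₁, v₂` it embeds the mixed
colourings `{v₁ ∉ K, v₂ ∉ L}` into `{v₁, v₂ ∉ K}` and yields the identity behind the deg-2 decomposition of conjecture SUPER).
[cite: KozmaNitzan2024, Questions 8–9 (§5.5 p. 36) (context: the Question-8 pocket covariance programme)]
-/

namespace Summit.CriticalPhenomena.PercolationContinuityZ3.Theorems

open Finset Literature.Probability.Percolation

namespace Coefficientwise

variable {ι V : Type*} [Fintype ι] [DecidableEq ι]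
variable (ends : ι → Sym2 V) (v : V)

/-- **After the half-zone flip the red cluster of `v` is its old blue cluster**: `C_v(s ∆ M) = C_v(sᶜ)` when `M` is the set of edges meeting `C_v(sᶜ)`.
[this work] -/
theorem openCluster_halfFlip (s M : Finset ι) (hM : ∀ i, i ∈ M ↔ ∃ u, u ∈ openCluster (ends '' (↑(sᶜ) : Set ι)) v ∧ u ∈ ends i) :
    openCluster (ends '' (↑(symmDiff s M) : Set ι)) v = openCluster (ends '' (↑(sᶜ) : Set ι)) v := by
  set ZB : Set V := openCluster (ends '' (↑(sᶜ) : Set ι)) v with hZB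
  have h1 : ∀ u ∈ ZB, ∀ w, (openGraph (ends '' (↑(symmDiff s M) : Set ι))).Adj u w →
      (openGraph (ends '' (↑(sᶜ) : Set ι))).Adj u w ∧ w ∈ ZB := by
    intro u hu w hadj
    rw [openGraph_image_adj] at hadj
    obtain ⟨⟨i, hiP, hi⟩, hne⟩ := hadj
    have hui : u ∈ ends i := by rw [hi]; exact Sym2.mem_mk_left u w
    have hwi : w ∈ ends i := by rw [hi]; exact Sym2.mem_mk_right u w
    have hiM : i ∈ M := (hM i).mpr ⟨u, hu, hui⟩
    have his : i ∉ s := by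
      rw [Finset.mem_symmDiff] at hiP
      rcases hiP with ⟨_, hnM⟩ | ⟨_, hns⟩
      · exact absurd hiM hnM
      · exact hns
    have hisc : i ∈ sᶜ := Finset.mem_compl.mpr his
    have hadj' : (openGraph (ends '' (↑(sᶜ) : Set ι))).Adj u w := by
      rw [openGraph_image_adj]; exact ⟨⟨i, hisc, hi⟩, hne⟩
    exact ⟨hadj', mem_openCluster_of_mem_ends ends sᶜ v hisc hu hui hwi⟩
  have h2 : ∀ u ∈ ZB, ∀ w, (openGraph (ends '' (↑(sᶜ) : Set ι))).Adj u w →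
      (openGraph (ends '' (↑(symmDiff s M) : Set ι))).Adj u w ∧ w ∈ ZB := by
    intro u hu w hadj
    rw [openGraph_image_adj] at hadj
    obtain ⟨⟨i, hisc, hi⟩, hne⟩ := hadj
    have hui : u ∈ ends i := by rw [hi]; exact Sym2.mem_mk_left u w
    have hwi : w ∈ ends i := by rw [hi]; exact Sym2.mem_mk_right u w
    have hiM : i ∈ M := (hM i).mpr ⟨u, hu, hui⟩
    have his : i ∉ s := Finset.mem_compl.mp hisc
    have hiP : i ∈ symmDiff s M := Finset.mem_symmDiff.mpr (Or.inr ⟨hiM, his⟩)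
    refine ⟨?_, mem_openCluster_of_mem_ends ends sᶜ v hisc hu hui hwi⟩
    rw [openGraph_image_adj]; exact ⟨⟨i, hiP, hi⟩, hne⟩
  have hv : v ∈ ZB := mem_openCluster_self _ v
  ext y
  constructor
  · rintro ⟨p⟩; exact ((reachable_transfer ZB h1 p) hv).2
  · rintro ⟨p⟩; exact ((reachable_transfer ZB h2 p) hv).1

/-- The red cluster of a vertex outside `C_v(sᶜ)` can only shrink under the half-zone flip: `C_x(s ∆ M) ⊆ C_x(s)`.  (A red walk from `x` never enters
`V(C_v sᶜ)`: an edge into that set which is red after the flip met it, so it was blue before, so both its ends were inside.) [this work] -/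
theorem openCluster_halfFlip_subset (x : V) (s M : Finset ι) (hM : ∀ i, i ∈ M ↔ ∃ u, u ∈ openCluster (ends '' (↑(sᶜ) : Set ι)) v ∧ u ∈ ends i)
    (hx : x ∉ openCluster (ends '' (↑(sᶜ) : Set ι)) v) :
    openCluster (ends '' (↑(symmDiff s M) : Set ι)) x ⊆ openCluster (ends '' (↑s : Set ι)) x := by
  set ZB : Set V := openCluster (ends '' (↑(sᶜ) : Set ι)) v with hZB
  set K : Set V := openCluster (ends '' (↑s : Set ι)) x with hK
  -- invariant: inside `K` and outside `ZB`
  have h : ∀ u ∈ (K ∩ ZBᶜ), ∀ w, (openGraph (ends '' (↑(symmDiff s M) : Set ι))).Adj u w →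
      (openGraph (ends '' (↑s : Set ι))).Adj u w ∧ w ∈ (K ∩ ZBᶜ) := by
    intro u hu w hadj
    rw [openGraph_image_adj] at hadj
    obtain ⟨⟨i, hiP, hi⟩, hne⟩ := hadj
    have hui : u ∈ ends i := by rw [hi]; exact Sym2.mem_mk_left u w
    have hwi : w ∈ ends i := by rw [hi]; exact Sym2.mem_mk_right u w
    -- the edge `i` is not at `ZB`: otherwise it was blue and both ends are in `ZB`, contradicting `u ∉ ZB`
    have hiM : i ∉ M := by
      intro hiM
      obtain ⟨u', hu'Z, hu'i⟩ := (hM i).mp hiM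
      have his : i ∉ s := by
        rw [Finset.mem_symmDiff] at hiP
        rcases hiP with ⟨_, hnM⟩ | ⟨_, hns⟩
        · exact absurd hiM hnM
        · exact hns
      have hisc : i ∈ sᶜ := Finset.mem_compl.mpr his
      have huZ : u ∈ ZB := mem_openCluster_of_mem_ends ends sᶜ v hisc hu'Z hu'i hui
      exact hu.2 huZ
    have his : i ∈ s := by
      rw [Finset.mem_symmDiff] at hiP
      rcases hiP with ⟨his, _⟩ | ⟨hiM', _⟩
      · exact his
      · exact absurd hiM' hiM
    have hadj' : (openGraph (ends '' (↑s : Set ι))).Adj u w := by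
      rw [openGraph_image_adj]; exact ⟨⟨i, his, hi⟩, hne⟩
    refine ⟨hadj', SimpleGraph.Reachable.trans hu.1 hadj'.reachable, ?_⟩
    intro hwZ
    exact hiM ((hM i).mpr ⟨w, hwZ, hwi⟩)
  intro y hy
  obtain ⟨p⟩ := hy
  have hx' : x ∈ K ∩ ZBᶜ := ⟨mem_openCluster_self _ x, hx⟩
  exact ((reachable_transfer (K ∩ ZBᶜ) h p) hx').2.1

/-- The blue cluster of a vertex outside `C_v(sᶜ)` can only grow under the half-zone flip: `C_x(sᶜ) ⊆ C_x((s ∆ M)ᶜ)`.  (The old blue cluster of `x` is disjoint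
from `C_v(sᶜ)`, so none of its edges is flipped.) [this work] -/
theorem openCluster_halfFlip_compl_supset (x : V) (s M : Finset ι) (hM : ∀ i, i ∈ M ↔ ∃ u, u ∈ openCluster (ends '' (↑(sᶜ) : Set ι)) v ∧ u ∈ ends i)
    (hx : x ∉ openCluster (ends '' (↑(sᶜ) : Set ι)) v) :
    openCluster (ends '' (↑(sᶜ) : Set ι)) x ⊆ openCluster (ends '' (↑((symmDiff s M)ᶜ) : Set ι)) x := by
  set ZB : Set V := openCluster (ends '' (↑(sᶜ) : Set ι)) v with hZB
  set L : Set V := openCluster (ends '' (↑(sᶜ) : Set ι)) x with hL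
  -- `L` is disjoint from `ZB`
  have hdisj : ∀ u ∈ L, u ∉ ZB := by
    intro u hu huZ
    exact hx (SimpleGraph.Reachable.trans huZ (SimpleGraph.Reachable.symm hu))
  have h : ∀ u ∈ L, ∀ w, (openGraph (ends '' (↑(sᶜ) : Set ι))).Adj u w →
      (openGraph (ends '' (↑((symmDiff s M)ᶜ) : Set ι))).Adj u w ∧ w ∈ L := by
    intro u hu w hadj
    have hadj0 := hadj
    rw [openGraph_image_adj] at hadj
    obtain ⟨⟨i, hisc, hi⟩, hne⟩ := hadj
    have hui : u ∈ ends i := by rw [hi]; exact Sym2.mem_mk_left u w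
    have hwi : w ∈ ends i := by rw [hi]; exact Sym2.mem_mk_right u w
    have hwL : w ∈ L := SimpleGraph.Reachable.trans hu hadj0.reachable
    have hiM : i ∉ M := by
      intro hiM
      obtain ⟨u', hu'Z, hu'i⟩ := (hM i).mp hiM
      -- `i` is blue with an end in `ZB`, so both ends are in `ZB`; but `u ∈ L` is not
      have huZ : u ∈ ZB := mem_openCluster_of_mem_ends ends sᶜ v hisc hu'Z hu'i hui
      exact hdisj u hu huZ
    have his : i ∉ s := Finset.mem_compl.mp hisc
    have hiPc : i ∈ (symmDiff s M)ᶜ := by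
      rw [Finset.mem_compl, Finset.mem_symmDiff]
      rintro (⟨hs, -⟩ | ⟨hm, -⟩)
      · exact his hs
      · exact hiM hm
    refine ⟨?_, hwL⟩
    rw [openGraph_image_adj]; exact ⟨⟨i, hiPc, hi⟩, hne⟩
  intro y hy
  obtain ⟨p⟩ := hy
  exact ((reachable_transfer L h p) (mem_openCluster_self _ x)).1

/-- The half-zone flip is undone by the red half-zone flip: if `M` is the set of edges at `C_v(sᶜ)` and `M'` the set of edges at `C_v(s ∆ M)`, then `M' = M` and
`(s ∆ M) ∆ M' = s`. [this work] -/
theorem halfFlip_halfFlip (s M M' : Finset ι) (hM : ∀ i, i ∈ M ↔ ∃ u, u ∈ openCluster (ends '' (↑(sᶜ) : Set ι)) v ∧ u ∈ ends i)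
    (hM' : ∀ i, i ∈ M' ↔ ∃ u, u ∈ openCluster (ends '' (↑(symmDiff s M) : Set ι)) v ∧ u ∈ ends i) :
    symmDiff (symmDiff s M) M' = s := by
  have hMM : M' = M := by
    ext i
    rw [hM i, hM' i, openCluster_halfFlip ends v s M hM]
  rw [hMM]
  exact symmDiff_symmDiff_cancel_right _ _

/-- `Π_v` maps `{x ∉ C_v(sᶜ)}` (i.e. `v ∉ C_x(sᶜ)`) into `{x ∉ C_v(s ∆ M)}` (i.e. `v ∉ C_x(s ∆ M)`), and never adds a vertex to the red cluster of `x`. [this work] -/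
theorem halfFlip_mem (x : V) (s M : Finset ι) (hM : ∀ i, i ∈ M ↔ ∃ u, u ∈ openCluster (ends '' (↑(sᶜ) : Set ι)) v ∧ u ∈ ends i)
    (hx : x ∉ openCluster (ends '' (↑(sᶜ) : Set ι)) v) :
    x ∉ openCluster (ends '' (↑(symmDiff s M) : Set ι)) v ∧
      ∀ u, u ∉ openCluster (ends '' (↑s : Set ι)) x → u ∉ openCluster (ends '' (↑(symmDiff s M) : Set ι)) x := by
  constructor
  · rw [openCluster_halfFlip ends v s M hM]; exact hx
  · intro u hu hu'
    exact hu (openCluster_halfFlip_subset ends v x s M hM hx hu')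

end Coefficientwise

end Summit.CriticalPhenomena.PercolationContinuityZ3.Theorems
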